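import Mathlib

/-!
# Tier4/Target.lean — the Tier-4 target `P_T4` (README §9; Tier-4 lead, 2026-08-28)

THE SENTENCE FORMALISED (route/TIER3.md v1.14 = route/m18/route/TIER3.md, §1 item 3, quoted verbatim):

«On a face, S4 is EQUIVALENT (ROUTE.md §1 row S4ᴾ, Lemma Π = Appendix A5, CELL from printed ingredients) to the period
statement, and closer **C7** (§4 item 2) reduces it to ONE crux at p = 2: **(P) for some choice of the Hecke translates,
⟨f^*Ω_s, f^*Ω_{s̄}⟩_{L²(X)} ≠ 0** — X a compact 2-ball quotient (Picard modular surface of an anisotropic hermitian 3-space V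
over a Galois CM field E′ ⊇ F, [E′⁺:ℚ] ≥ 2) whose Albanese has the four corners as isogeny factors (Liu 2021 Cor 4.20,
UNCONDITIONAL at n = 3 — ROUTE.md §4 item 2 «at p = 2, n = 3, UNCONDITIONAL — Liu Rem 4.14, DR Thm 3.2»), f the product of
Hecke-translated Albanese maps, f^*Ω_s = θ(μ_0) ∧ θ(μ_1) and f^*Ω_{s̄} = θ(μ_2) ∧ θ(μ_3) wedges of theta lifts of
U(1)-characters (BMM Cor 65 / Liu Prop 4.13, PRINTED).»

with the face = a rank-four face of a Galois CM field F (§1 item 2: four CM types T_0, …, T_3 with Σ_i 1_{T_i} ≡ 2), and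
Ω_s := ∧_{i : s ∈ T_i} ω_{i,s}, Ω_{s̄} := ∧_{i : s̄ ∈ T_i} ω_{i,s̄} (ROUTE.md §4 item 2), ω_{i,s} the holomorphic eigen-1-form of the
corner A_{T_i} for the embedding s, and ⟨α, β⟩_{L²(X)} the L² (Hodge) inner product of holomorphic 2-forms on X
(ROUTE.md §4 item 2: ∫_X f^*Ω_s ∧ conj(f^*Ω_{s̄}) = i^{p²}·⟨f^*Ω_s, f^*Ω_{s̄}⟩_{L²(X)}).

## How the objects are realised (everything CONCRETE; nothing abstract carries the content)

* F: a Galois CM number field (Mathlib `IsGalois ℚ F`, `NumberField.IsCMField F`). A CM type is a set T of complex embeddings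
  containing exactly one of each conjugate pair; a rank-four face is four CM types with every embedding in exactly two of them.
* E′ ⊇ F: a Galois CM number field with an embedding ι : F → E′ and [E′⁺ : ℚ] ≥ 2 (E′⁺ = `maximalRealSubfield E′`);
  c′ = `IsCMField.complexConj E′` is its complex conjugation (τ ∘ c′ = conj ∘ τ for every embedding τ, Mathlib).
* V: the hermitian 3-space E′³ with matrix H (c′-hermitian, form ⟨x, y⟩ = c′(x)ᵀ H y), ANISOTROPIC; a distinguished
  embedding τ₀ at which τ₀(H) has signature (2,1) (a Sylvester matrix C with Cᴴ τ₀(H) C = ±J, J = diag(1,1,−1), the sealed `BallModel.J`), and τ(H) DEFINITE at every embedding τ ∉ {τ₀, conj ∘ τ₀}: this is what makes U(V) act on the complex 2-ball with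
  a compact arithmetic quotient (a Picard modular surface). U(H)(E′) = {g : c′(g)ᵀ H g = H}.
* Γ: a congruence subgroup of U(H)(𝒪_{E′}) (contains a principal congruence subgroup Γ(N), N ≥ 1). Γ acts on the ball 𝔹² ⊂ ℂ²
  through M(g) = C⁻¹ τ₀(g) C ∈ U(2,1) by the fractional-linear action of the sealed `BallModel` (`actM` below agrees with
  `BallModel.act` on the ball for M ∈ U(2,1)); X = Γ\𝔹².
* The corner A_{T_i}: the complex torus ℂ^{T_i}/Λ_i, Λ_i ANY ℤ-lattice (Mathlib `IsZLattice ℝ`) stable under the CM-type action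
  x ↦ (σ(x))_{σ ∈ T_i} of 𝒪_F — i.e. any complex abelian variety with CM by (F, T_i); its holomorphic eigen-1-forms are the
  coordinate forms dz_σ (σ ∈ T_i), and ω_{i,s} = dz_s.
* «Alb(X) has A_{T_i} as an isogeny factor» + «the Albanese map X → A_{T_i}»: a holomorphic map X → A_{T_i} is a holomorphic
  a_i : 𝔹² → ℂ^{T_i} with a_i(γ z) − a_i(z) ∈ Λ_i (γ ∈ Γ); the induced homomorphism Alb(X) → A_{T_i} is surjective iff the
  differences a_i(z) − a_i(z′) span ℂ^{T_i} over ℂ (iff no non-zero invariant 1-form of A_{T_i} pulls back to 0). `IsAlbaneseLift`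
  is exactly this; P_T4 quantifies over EVERY such a_i (every Albanese map onto every corner of the listed kind).
* Hecke translates (the Hecke algebra of Γ′ acting as correspondences on a common congruence cover Γ′ ≤ Γ): a Hecke element is a
  finite ℤ-linear combination of double cosets Γ′gΓ′ (g ∈ U(H)(E′)), each given by a complete system R of representatives of
  Γ′\Γ′gΓ′; it acts on a lift a by a ↦ Σ_terms c · Σ_{r ∈ R} a ∘ M(r). The Hecke-translated Albanese map is `heckeTranslate h a`.
* f^*Ω_s on 𝔹² = the wedge (Jacobian determinant) of the two translated eigen-1-forms d(a_{i₁})_s, d(a_{i₂})_s for the two corners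
  i₁ ≠ i₂ containing s: `jacDet (comp … s …) (comp … s …)`; likewise f^*Ω_{s̄} for the two corners containing s̄ = conj ∘ s.
* ⟨f^*Ω_s, f^*Ω_{s̄}⟩_{L²(X)}: the integral over a measurable fundamental domain D ⊂ 𝔹² of Γ′ of jac_s · conj(jac_{s̄}) against
  Lebesgue measure on ℂ² — this is ∫_X f^*Ω_s ∧ conj(f^*Ω_{s̄}) up to a non-zero absolute constant (the density
  jac_s · conj(jac_{s̄}) · dLeb is Γ′-invariant by the chain rule, so the value does not depend on D).

## Quantifier shape (critic test F1): every free datum of the listed kind is quantified UNIVERSALLY (F, the face, E′, ι, H, τ₀,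
C, Γ, s, the lattices, the Albanese maps, the labelling i₁ … i₄ of the corners containing s resp. s̄); the ONLY existential
quantifiers are (P)'s own «for some choice of the Hecke translates» (the congruence cover Γ′ ≤ Γ and the four Hecke elements)
and the fundamental domain D (its existence is a theorem of the setting; ∃ keeps the statement non-vacuous).

## Hypotheses BUILT INTO the statement (README §9) — all of them are the setting of (P) as §1 item 3 states it, none is a route fact:
(H1) F Galois CM, (T_i) a rank-four face; (H2) E′ ⊇ F Galois CM with [E′⁺:ℚ] ≥ 2; (H3) V = E′³ with an anisotropic c′-hermitian
matrix H of signature (2,1) at τ₀ and definite at the other embeddings (this is «compact 2-ball quotient / Picard modular surface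
of an anisotropic hermitian 3-space»; compactness itself is not assumed — it follows from the definite place by Godement, and if it
failed the integral's junk value 0 would make the statement FALSE, never vacuous); (H4) Γ a congruence subgroup of U(H);
(H5) the four corners are isogeny factors of Alb(X), realised by Albanese lifts a_i as above (Liu 2021 Cor 4.20 is the existence
statement for such X; here it is the hypothesis under which (P) is asserted, exactly as in §1 item 3).
NOT built in: the identification f^*Ω_s = θ(μ_0) ∧ θ(μ_1) (BMM Cor 65 / Liu Prop 4.13) — f^*Ω_s is literally the pull-back;
no seesaw / doubling identity, no L-value, no density theorem, no non-vanishing of any kind appears in the statement.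
Normalisations without loss: V written on a basis (E′³, H); the corner lattice Λ_i arbitrary 𝒪_F-stable (so every A of
type (F, T_i) is covered); ω_{i,s} = dz_s (the eigen-1-form up to a non-zero scalar); the L² pairing up to a non-zero constant.

Nothing in this file asserts anything about the truth of (P); HC_CM is NOT proved by anyone in this repository.
-/

set_option autoImplicit false

noncomputable section

open Matrix MeasureTheory NumberField
open scoped ComplexConjugate ComplexOrder

namespace Summit.Ventures.HodgeRepro.Tier4

/-! ## 0. Three definitions copied VERBATIM from the sealed `Summits/Ventures/HodgeRepro/BallModel.lean`
(`BallModel.J`, `BallModel.nsq`, `BallModel.wedge`), so that this file imports Mathlib only. -/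

/-- `J = diag(1, 1, -1)` on `ℂ³` (= the sealed `BallModel.J`). -/
def J : Matrix (Fin 3) (Fin 3) ℂ := Matrix.diagonal ![1, 1, -1]

/-- `|z₀|² + |z₁|²` (= the sealed `BallModel.nsq`). -/
def nsq (z : Fin 2 → ℂ) : ℝ := ‖z 0‖ ^ 2 + ‖z 1‖ ^ 2

/-- `a ∧ b = a₀ b₁ - a₁ b₀` (= the sealed `BallModel.wedge`). -/
def wedge (a b : Fin 2 → ℂ) : ℂ := a 0 * b 1 - a 1 * b 0

/-! ## A. CM fields, CM types, rank-four faces -/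

/-- The complex-conjugate embedding `conj ∘ σ`. -/
def conjEmb {K : Type*} [Field K] (σ : K →+* ℂ) : K →+* ℂ := (starRingEnd ℂ).comp σ

/-- A CM type of `K`: a set of complex embeddings containing exactly one of each conjugate pair `{σ, conj ∘ σ}`. -/
def IsCMType (K : Type*) [Field K] (T : Finset (K →+* ℂ)) : Prop :=
  ∀ σ : K →+* ℂ, σ ∈ T ↔ conjEmb σ ∉ T

/-- A rank-four face of `K` (TIER3.md §1 item 2): four CM types `T₀, …, T₃` with every embedding in EXACTLY two of them
(`Σ_i 1_{T_i} ≡ 2`). -/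
def IsRankFourFace (K : Type*) [Field K] (T : Fin 4 → Finset (K →+* ℂ)) : Prop :=
  (∀ i, IsCMType K (T i)) ∧ ∀ σ : K →+* ℂ, ∃ i j : Fin 4, i ≠ j ∧ ∀ k, σ ∈ T k ↔ (k = i ∨ k = j)

/-! ## B. The hermitian 3-space `V = E′³`, its unitary group, congruence subgroups -/

section Hermitian

variable {E : Type*} [Field E]

/-- The `c`-conjugate transpose `c(A)ᵀ` of a matrix over `E`, for a ring automorphism `c` of `E`. -/
def cstar (c : E ≃+* E) (A : Matrix (Fin 3) (Fin 3) E) : Matrix (Fin 3) (Fin 3) E := (A.map c)ᵀ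

/-- `H` is `c`-hermitian: `c(H)ᵀ = H`. -/
def IsCHermitian (c : E ≃+* E) (H : Matrix (Fin 3) (Fin 3) E) : Prop := cstar c H = H

/-- The hermitian form `⟨x, y⟩_H = c(x)ᵀ H y` (conjugate-linear in the first variable — the convention of the sealed
`BallModel`: `star v ⬝ᵥ (J *ᵥ v)`). -/
def hform (c : E ≃+* E) (H : Matrix (Fin 3) (Fin 3) E) (x y : Fin 3 → E) : E :=
  (fun i => c (x i)) ⬝ᵥ (H *ᵥ y)

/-- `V` is anisotropic: `⟨x, x⟩_H = 0` only for `x = 0`. -/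
def Anisotropic (c : E ≃+* E) (H : Matrix (Fin 3) (Fin 3) E) : Prop :=
  ∀ x : Fin 3 → E, hform c H x x = 0 → x = 0

/-- `g ∈ U(H)`: `c(g)ᵀ H g = H`. -/
def IsUnitaryOf (c : E ≃+* E) (H g : Matrix (Fin 3) (Fin 3) E) : Prop := cstar c g * H * g = H

/-- All entries of `g` are algebraic integers. -/
def IsIntegralMatrix (g : Matrix (Fin 3) (Fin 3) E) : Prop := ∀ i j, IsIntegral ℤ (g i j)

/-- The principal congruence subgroup `Γ(N) = {g ∈ U(H)(𝒪) : g ≡ 1 mod N}` (for the lattice `𝒪³`); `Γ(1) = U(H)(𝒪)`. -/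
def principalCongruence (c : E ≃+* E) (H : Matrix (Fin 3) (Fin 3) E) (N : ℕ) : Set (Matrix (Fin 3) (Fin 3) E) :=
  {g | IsUnitaryOf c H g ∧ IsIntegralMatrix g ∧
    ∀ i j, ∃ x : E, IsIntegral ℤ x ∧ g i j - (1 : Matrix (Fin 3) (Fin 3) E) i j = (N : E) * x}

/-- `Γ` is a congruence subgroup of `U(H)`: a subgroup with `Γ(N) ⊆ Γ ⊆ Γ(1)` for some `N ≥ 1`. -/
def IsCongruenceSubgroup (c : E ≃+* E) (H : Matrix (Fin 3) (Fin 3) E) (Γ : Set (Matrix (Fin 3) (Fin 3) E)) : Prop :=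
  (1 ∈ Γ) ∧ (∀ g ∈ Γ, ∀ h ∈ Γ, g * h ∈ Γ) ∧ (∀ g ∈ Γ, ∃ h ∈ Γ, g * h = 1) ∧
  Γ ⊆ principalCongruence c H 1 ∧ ∃ N : ℕ, 1 ≤ N ∧ principalCongruence c H N ⊆ Γ

end Hermitian

/-! ## C. The ball model: signature, transfer to `U(2,1)`, the action on `𝔹² ⊂ ℂ²` -/

/-- A hermitian matrix over `ℂ` is definite (positive or negative). -/
def IsDefinite (M : Matrix (Fin 3) (Fin 3) ℂ) : Prop := M.PosDef ∨ (-M).PosDef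

/-- `C` is a Sylvester matrix exhibiting signature `(2,1)` for `M`: `Cᴴ M C = ±J`, `J = diag(1,1,−1)`. -/
def IsSylvester (M C : Matrix (Fin 3) (Fin 3) ℂ) : Prop :=
  IsUnit C ∧ (Cᴴ * M * C = J ∨ Cᴴ * M * C = -J)

/-- The transfer `M(g) = C⁻¹ τ₀(g) C` of a matrix over `E` to the ball model (lies in `U(2,1)` for `g ∈ U(H)`). -/
def toBallMat {E : Type*} [Field E] (τ₀ : E →+* ℂ) (C : Matrix (Fin 3) (Fin 3) ℂ)
    (g : Matrix (Fin 3) (Fin 3) E) : Matrix (Fin 3) (Fin 3) ℂ :=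
  C⁻¹ * g.map τ₀ * C

/-- Homogeneous coordinates `(z₀, z₁, 1)` of a point of `ℂ²`. -/
def lift3 (z : Fin 2 → ℂ) : Fin 3 → ℂ := ![z 0, z 1, 1]

/-- The fractional-linear action `z ↦ ((M(z,1))₀, (M(z,1))₁) / (M(z,1))₂` of a `3×3` complex matrix on `ℂ²`
(junk where the denominator vanishes; on the ball and for `M ∈ U(2,1)` it is `BallModel.act`). -/
def actM (M : Matrix (Fin 3) (Fin 3) ℂ) (z : Fin 2 → ℂ) : Fin 2 → ℂ :=
  fun k => (M *ᵥ lift3 z) (Fin.castSucc k) / (M *ᵥ lift3 z) 2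

/-- The open unit ball `𝔹² = {|z₀|² + |z₁|² < 1}` as a subset of `ℂ²`. -/
def ball : Set (Fin 2 → ℂ) := {z | nsq z < 1}

/-- The set of self-maps of `ℂ²` through which `Γ` acts on the ball. -/
def ballActions {E : Type*} [Field E] (τ₀ : E →+* ℂ) (C : Matrix (Fin 3) (Fin 3) ℂ)
    (Γ : Set (Matrix (Fin 3) (Fin 3) E)) : Set ((Fin 2 → ℂ) → (Fin 2 → ℂ)) :=
  (fun γ => actM (toBallMat τ₀ C γ)) '' Γ

/-- `D` is a measurable fundamental domain in the ball for a set `S` of self-maps of `ℂ²`: almost every point of the ball has a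
translate in `D`, and the images of `D` under two DIFFERENT maps of `S` are almost disjoint. -/
def IsFundamentalDomainFor (S : Set ((Fin 2 → ℂ) → (Fin 2 → ℂ))) (D : Set (Fin 2 → ℂ)) : Prop :=
  MeasurableSet D ∧ D ⊆ ball ∧
  (∀ᵐ z ∂(volume.restrict ball), ∃ φ ∈ S, φ z ∈ D) ∧
  (∀ φ ∈ S, ∀ ψ ∈ S, φ ≠ ψ → volume (φ '' D ∩ ψ '' D) = 0)

/-! ## D. Hecke translates -/

/-- `R` is a complete system of representatives of the right cosets `Γ r ⊆ Γ g Γ`. -/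
def IsCosetReps {E : Type*} [Field E] (Γ : Set (Matrix (Fin 3) (Fin 3) E)) (g : Matrix (Fin 3) (Fin 3) E)
    (R : Finset (Matrix (Fin 3) (Fin 3) E)) : Prop :=
  (∀ r ∈ R, ∃ γ₁ ∈ Γ, ∃ γ₂ ∈ Γ, r = γ₁ * g * γ₂) ∧
  (∀ γ₁ ∈ Γ, ∀ γ₂ ∈ Γ, ∃! r, r ∈ R ∧ ∃ γ ∈ Γ, γ₁ * g * γ₂ = γ * r)

/-- A Hecke element: a finite `ℤ`-linear combination of double cosets, each double coset given by a system of right-coset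
representatives. -/
structure HeckeElement (E : Type*) [Field E] where
  /-- the terms `(coefficient, representatives of Γ\ΓgΓ)` -/
  terms : List (ℤ × Finset (Matrix (Fin 3) (Fin 3) E))

/-- `h` is an element of the Hecke algebra of `Γ` inside `U(H)(E)`: every term is a double coset `Γ g Γ`, `g ∈ U(H)(E)`. -/
def HeckeElement.IsFor {E : Type*} [Field E] (c : E ≃+* E) (H : Matrix (Fin 3) (Fin 3) E)
    (Γ : Set (Matrix (Fin 3) (Fin 3) E)) (h : HeckeElement E) : Prop :=
  ∀ t ∈ h.terms, ∃ g : Matrix (Fin 3) (Fin 3) E, IsUnitaryOf c H g ∧ IsCosetReps Γ g t.2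

/-- The Hecke translate `(T_h a)(z) = Σ_terms c · Σ_{r ∈ R} a(M(r) z)` of a lift `a : ℂ² → W`. -/
def heckeTranslate {E : Type*} [Field E] {W : Type*} [AddCommGroup W] (τ₀ : E →+* ℂ) (C : Matrix (Fin 3) (Fin 3) ℂ)
    (h : HeckeElement E) (a : (Fin 2 → ℂ) → W) : (Fin 2 → ℂ) → W :=
  fun z => (h.terms.map (fun t => t.1 • (t.2.sum (fun r => a (actM (toBallMat τ₀ C r) z))))).sum

/-! ## E. Corners, Albanese lifts, the eigen-1-forms and their wedge -/

/-- `Λ ⊆ ℂ^T` is stable under the CM-type action `x ↦ (σ(x))_{σ ∈ T}` of the algebraic integers of `K`. -/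
def IsOFStable {K : Type*} [Field K] (T : Finset (K →+* ℂ)) (Λ : Submodule ℤ (↥T → ℂ)) : Prop :=
  ∀ x : K, IsIntegral ℤ x → ∀ v ∈ Λ, (fun σ : ↥T => σ.1 x * v σ) ∈ Λ

/-- An Albanese lift onto the corner `ℂ^T/Λ`: holomorphic on the ball, `Γ`-equivariant modulo `Λ`, and with differences spanning
`ℂ^T` (⟺ the induced homomorphism `Alb(X) → ℂ^T/Λ` is surjective, i.e. the corner is an isogeny factor of `Alb(X)`). -/
def IsAlbaneseLift {K : Type*} [Field K] {E : Type*} [Field E] (T : Finset (K →+* ℂ)) (Λ : Submodule ℤ (↥T → ℂ))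
    (τ₀ : E →+* ℂ) (C : Matrix (Fin 3) (Fin 3) ℂ) (Γ : Set (Matrix (Fin 3) (Fin 3) E))
    (a : (Fin 2 → ℂ) → (↥T → ℂ)) : Prop :=
  DifferentiableOn ℂ a ball ∧
  (∀ γ ∈ Γ, ∀ z ∈ ball, a (actM (toBallMat τ₀ C γ) z) - a z ∈ Λ) ∧
  Submodule.span ℂ {w : ↥T → ℂ | ∃ z ∈ ball, ∃ z' ∈ ball, w = a z - a z'} = ⊤

/-- The `s`-coordinate of a lift `A : ℂ² → ℂ^T` (`s ∈ T`): the function whose differential is `A^*dz_s`. -/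
def comp {K : Type*} [Field K] (T : Finset (K →+* ℂ)) (s : K →+* ℂ) (hs : s ∈ T)
    (A : (Fin 2 → ℂ) → (↥T → ℂ)) : (Fin 2 → ℂ) → ℂ :=
  fun z => A z ⟨s, hs⟩

/-- The partial derivative `∂u/∂z_k`. -/
def pd (k : Fin 2) (u : (Fin 2 → ℂ) → ℂ) (z : Fin 2 → ℂ) : ℂ := fderiv ℂ u z (Pi.single k 1)

/-- The coefficient of `du ∧ dv` on `dz₀ ∧ dz₁`: the Jacobian determinant `∂₀u ∂₁v − ∂₁u ∂₀v` (`wedge`). -/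
def jacDet (u v : (Fin 2 → ℂ) → ℂ) (z : Fin 2 → ℂ) : ℂ :=
  wedge (fun k => pd k u z) (fun k => pd k v z)

/-! ## F. The target -/

/-- **P_T4** — the statement (P) of TIER3.md §1 item 3, as described in the module docstring. -/
def P_T4 : Prop :=
  ∀ (F : Type) [Field F] [NumberField F] [IsGalois ℚ F] [IsCMField F]
    (T : Fin 4 → Finset (F →+* ℂ)), IsRankFourFace F T →
  ∀ (E : Type) [Field E] [NumberField E] [IsGalois ℚ E] [IsCMField E],
    2 ≤ Module.finrank ℚ (maximalRealSubfield E) →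
  ∀ (_ι : F →+* E) (H : Matrix (Fin 3) (Fin 3) E),
    IsCHermitian (IsCMField.complexConj E).toRingEquiv H →
    Anisotropic (IsCMField.complexConj E).toRingEquiv H →
  ∀ (τ₀ : E →+* ℂ), (∀ τ : E →+* ℂ, τ ≠ τ₀ → τ ≠ conjEmb τ₀ → IsDefinite (H.map τ)) →
  ∀ (C : Matrix (Fin 3) (Fin 3) ℂ), IsSylvester (H.map τ₀) C →
  ∀ (Γ : Set (Matrix (Fin 3) (Fin 3) E)), IsCongruenceSubgroup (IsCMField.complexConj E).toRingEquiv H Γ →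
  ∀ (s : F →+* ℂ)
    (Λ : ∀ i : Fin 4, Submodule ℤ (↥(T i) → ℂ)) [∀ i, DiscreteTopology (Λ i)] [∀ i, IsZLattice ℝ (Λ i)],
    (∀ i, IsOFStable (T i) (Λ i)) →
  ∀ (a : ∀ i : Fin 4, (Fin 2 → ℂ) → (↥(T i) → ℂ)), (∀ i, IsAlbaneseLift (T i) (Λ i) τ₀ C Γ (a i)) →
  ∀ (i₁ i₂ i₃ i₄ : Fin 4), i₁ ≠ i₂ → i₃ ≠ i₄ →
  ∀ (hs₁ : s ∈ T i₁) (hs₂ : s ∈ T i₂) (hs₃ : conjEmb s ∈ T i₃) (hs₄ : conjEmb s ∈ T i₄),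
  ∃ (Γ' : Set (Matrix (Fin 3) (Fin 3) E)),
    IsCongruenceSubgroup (IsCMField.complexConj E).toRingEquiv H Γ' ∧ Γ' ⊆ Γ ∧
  ∃ (h : Fin 4 → HeckeElement E), (∀ i, (h i).IsFor (IsCMField.complexConj E).toRingEquiv H Γ') ∧
  ∃ (D : Set (Fin 2 → ℂ)), IsFundamentalDomainFor (ballActions τ₀ C Γ') D ∧
    ∫ z in D,
      jacDet (comp (T i₁) s hs₁ (heckeTranslate τ₀ C (h i₁) (a i₁)))
             (comp (T i₂) s hs₂ (heckeTranslate τ₀ C (h i₂) (a i₂))) z *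
      conj (jacDet (comp (T i₃) (conjEmb s) hs₃ (heckeTranslate τ₀ C (h i₃) (a i₃)))
                   (comp (T i₄) (conjEmb s) hs₄ (heckeTranslate τ₀ C (h i₄) (a i₄))) z) ≠ 0

end Summit.Ventures.HodgeRepro.Tier4

end
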